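import Mathlib

/-!
# Substitution step for elementary words (`stub_wordSubst`)

A *letter* `l : Fin 3 × Fin 3 × ℂ × Option σ` encodes the elementary matrix
`Matrix.transvection l.1 l.2.1 (C l.2.2.1 * l.2.2.2.elim 1 X)`, i.e. `E_ij(c)` (variable slot
`none`) or `E_ij(c · x_v)` (variable slot `some v`); the matrix of a word is the product of its
letters.  Freezing every off-block variable `x_v` (those with `¬ p v`) at the complex value `x v`
turns the letter `E_ij(c x_v)` into the constant letter `E_ij(c · x v)`, keeps block letters, and
the matrix of the resulting word is the entrywise image of the old matrix under the substitution
algebra homomorphism `aeval (v ↦ if p v then X v else C (x v))`.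
-/

set_option linter.dupNamespace false

namespace Summit.ValiantsHypothesis.ValiantsHypothesis.Theorems.WordPerSuperQuartic

open MvPolynomial

/-- Functoriality of transvections under an entrywise ring homomorphism. -/
private theorem wordSubst_transvection_map {m R S : Type*} [DecidableEq m] [Fintype m]
    [CommRing R] [CommRing S] (f : R →+* S) (i j : m) (c : R) :
    (Matrix.transvection i j c).map f = Matrix.transvection i j (f c) := by
  ext k l
  simp only [Matrix.transvection, Matrix.map_apply, Matrix.add_apply, Matrix.one_apply,
    Matrix.single_apply]
  split_ifs <;> simp

/-- An entrywise ring homomorphism maps the matrix of a word to the product of the mapped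
letters. -/
private theorem wordSubst_mapMatrix_wordProd {σ R S : Type*} [CommRing R] [CommRing S]
    (f : MvPolynomial σ R →+* S) (w : List (Fin 3 × Fin 3 × R × Option σ)) :
    f.mapMatrix (w.map (fun l => Matrix.transvection l.1 l.2.1
        (C l.2.2.1 * l.2.2.2.elim 1 X))).prod =
      (w.map (fun l => Matrix.transvection l.1 l.2.1
        (f (C l.2.2.1) * l.2.2.2.elim 1 (fun v => f (X v))))).prod := by
  rw [map_list_prod, List.map_map]
  congr 1
  apply List.map_congr_left
  intro l _
  simp only [Function.comp_apply, RingHom.mapMatrix_apply, wordSubst_transvection_map, map_mul]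
  congr 2
  cases l.2.2.2 <;> simp

/-- **Substitution step.**  Freezing the off-block variables (`¬ p v`) of every letter at the
values `x` yields a word whose matrix is the entrywise image of the original word's matrix under
the substitution homomorphism `aeval (v ↦ if p v then X v else C (x v))`. -/
theorem stub_wordSubst {σ : Type} [DecidableEq σ] (p : σ → Prop) [DecidablePred p] (x : σ → ℂ)
    (w : List (Fin 3 × Fin 3 × ℂ × Option σ)) :
    ((w.map (fun l => if l.2.2.2.any (fun v => decide (p v)) then l
        else (l.1, l.2.1, l.2.2.1 * l.2.2.2.elim 1 x, none))).map
        (fun l => Matrix.transvection l.1 l.2.1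
          (C l.2.2.1 * l.2.2.2.elim 1 X : MvPolynomial σ ℂ))).prod =
      (aeval (fun v : σ => if p v then (X v : MvPolynomial σ ℂ) else C (x v))).toRingHom.mapMatrix
        (w.map (fun l => Matrix.transvection l.1 l.2.1
          (C l.2.2.1 * l.2.2.2.elim 1 X : MvPolynomial σ ℂ))).prod := by
  rw [wordSubst_mapMatrix_wordProd, List.map_map]
  congr 1
  apply List.map_congr_left
  intro l _
  obtain ⟨i, j, c, o⟩ := l
  simp only [Function.comp_apply, AlgHom.toRingHom_eq_coe, RingHom.coe_coe, algHom_C]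
  cases o with
  | none => simp
  | some v =>
    by_cases hv : p v
    · simp [hv]
    · simp [hv, map_mul]
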